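import Mathlib
import Literature.Analysis.ODE.GalerkinProjectionLp
import Literature.Analysis.FunctionSpaces.LatticeConvolutionCommutator
import Literature.Analysis.FunctionSpaces.LatticeSymbolAlgebra
import Literature.Analysis.FunctionSpaces.LatticeSobolevDeriv
import Summits.NavierStokesRegularity.FluidComputer.GalerkinLatticePhaseSpace
import HarnessLib

/-!
# The transport Galerkin model on the `H²`-scaled lattice phase space: definitions (instab g17, cell `ns-blowup`, 2026-08-27)

HONEST FRAMING (human ruling D-0035): nothing here is a claim about Navier–Stokes blow-up.
WHAT THIS IS NOT: not NS evidence — the DEFINITIONS (and their unfolding lemmas, nothing else) of the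
model instance «(β2)» of the R-β emergence chain (`HOME/instab/BETA2-SPEC.md` §1–§3,
`INSTAB-BRIDGE.md` l.132): the perturbation equation of a forced steady flow on the torus, written
on Fourier coefficients in the `H²`-scaled `ℓ²` phase space of `GalerkinLatticePhaseSpace`.

Objects (parameters: a viscosity `ν`, the host's coefficient family `Uv : ℤ^d → V`, coordinate
functionals `π_j : V →L[ℂ] ℂ` reading the velocity components, and a modewise projection family
`P(k) : V →L[ℂ] V` — the Leray symbol in the application):

* `ofCoeff f` — the element of `E = lp (fun _ : ℤ^d => V) 2` with coefficient family `f` when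
  `f ∈ ℓ²`, and `0` otherwise (junk off `ℓ²`; only values on the box `W` and on finitely supported
  families are ever used downstream).
* `linCoeff ν Uv π u = ν ∑_j ∂_j∂_j u − ∑_j (π_j ∘ Uv) ⋆ ∂_j u − ∑_j (π_j ∘ u) ⋆ ∂_j Uv` — the
  coefficient-level linearisation `νΔu − (U·∇)u − (u·∇)U` in the vocabulary of
  `TransportLinearisedLattice.re_pairing_wmul_two_linearised_le` (transport family
  `T_y x = ∑_j Lattice.conv (Lattice.scal (y j)) (Lattice.freqDeriv j x)`).
* `bilCoeff π u v = −∑_j (π_j ∘ u) ⋆ ∂_j v` — the coefficient-level bilinearity `−(u·∇)v`.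
* `linOp`, `bilOp` — the same maps on `E` in SCALED coordinates `⇑x = Λ² û` (`û = Λ⁻² ⇑x`,
  `Lattice.wmul`), projected modewise by `P` and re-scaled: `A x = ofCoeff (Λ² (P ∘ lin û))`,
  `B x y = ofCoeff (Λ² (P ∘ bil û v̂))`; `nsField = A + B(·,·)` (so the split hypothesis `hF` of
  `GalerkinEmergenceCertificate.half_prediction_of_head_tail_certificate` is `rfl`).
* `box ρ π P` — the set `W` of self-consistent bounds: the coordinate box `‖x k‖ ≤ ρ k` cut by the
  three closed, truncation-invariant linear constraints «`P`-fixed modewise», «real through `π`»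
  (`π_j (x (−k)) = conj (π_j (x k))`), «divergence-free through `π`» (`∑_j k_j π_j (x k) = 0`).
* `cubeProj n` — the coordinate projection of `E` onto the cube `{k : ∀ i, |k i| ≤ n}`
  (`Literature.Analysis.ODE.lpProj`; an `abbrev` for the spelled-out form used by
  `GalerkinLatticePhaseSpace` / `GalerkinLatticeOneSided`).

No estimate is proved here; the instance theorems (compactness and invariance of `W`, conditions
(C1)/(C2) of `Literature.Analysis.ODE.GalerkinConvergenceSetting` with box-suprema constants) live in
the sibling `TransportGalerkin*` files. General `d` (finite type) and `V` (complex normed space).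
-/

noncomputable section

namespace Summit.NavierStokesRegularity.FluidComputer.TransportGalerkin

open Finset
open Literature.Analysis.FunctionSpaces Literature.Analysis.FunctionSpaces.Lattice
open Literature.Analysis.FunctionSpaces.Torus Literature.Analysis.ODE
open Summit.NavierStokesRegularity.FluidComputer.GalerkinLatticePhaseSpace
open scoped ENNReal NNReal ComplexConjugate

variable {d : Type*} [Fintype d]
variable {V : Type*} [NormedAddCommGroup V]

/-! ## §1 Coefficient families as elements of the phase space -/

/-- **The `ℓ²` element with a given coefficient family** (`0` if the family is not square-summable). -/
def ofCoeff (f : (d → ℤ) → V) : lp (fun _ : (d → ℤ) => V) 2 :=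
  haveI := Classical.dec (Memℓp f 2)
  if h : Memℓp f 2 then ⟨f, h⟩ else 0

omit [Fintype d] in
/-- On square-summable families `ofCoeff` has the given coefficients. -/
theorem coe_ofCoeff {f : (d → ℤ) → V} (h : Memℓp f 2) : ⇑(ofCoeff f) = f := by
  rw [ofCoeff, dif_pos h]

omit [Fintype d] in
/-- Off `ℓ²`, `ofCoeff` is the junk value `0`. -/
theorem ofCoeff_of_not_memℓp {f : (d → ℤ) → V} (h : ¬ Memℓp f 2) : ofCoeff f = 0 := by
  rw [ofCoeff, dif_neg h]

/-- On families of finite lattice `H⁰` norm `ofCoeff` has the given coefficients. -/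
theorem coe_ofCoeff_of_eNormSq_lt_top {f : (d → ℤ) → V} (h : eNormSq 0 f < ∞) : ⇑(ofCoeff f) = f :=
  coe_ofCoeff ((memℓp_two_iff_eNormSq_zero_lt_top f).2 h)

/-! ## §2 The coefficient-level fields -/

section Fields

variable [NormedSpace ℂ V]

/-- **The linearised field at the coefficient level**, `νΔu − (U·∇)u − (u·∇)U` on Fourier
coefficients: `ν ∑_j ∂_j∂_j u − ∑_j (π_j ∘ Uv) ⋆ ∂_j u − ∑_j (π_j ∘ u) ⋆ ∂_j Uv` (the host enters as
advecting symbol through its components `π_j ∘ Uv` and as advected target `Uv`). -/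
def linCoeff (ν : ℝ) (Uv : (d → ℤ) → V) (π : d → (V →L[ℂ] ℂ)) (u : (d → ℤ) → V) : (d → ℤ) → V :=
  (ν : ℂ) • (∑ j, freqDeriv j (freqDeriv j u))
    - ∑ j, conv (scal (fun p => π j (Uv p))) (freqDeriv j u)
    - ∑ j, conv (scal (fun p => π j (u p))) (freqDeriv j Uv)

/-- **The bilinear field at the coefficient level**, `−(u·∇)v` on Fourier coefficients:
`−∑_j (π_j ∘ u) ⋆ ∂_j v`. -/
def bilCoeff (π : d → (V →L[ℂ] ℂ)) (u v : (d → ℤ) → V) : (d → ℤ) → V :=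
  -∑ j, conv (scal (fun p => π j (u p))) (freqDeriv j v)

omit [Fintype d] in
/-- Unfolding of `bilCoeff`. -/
theorem bilCoeff_eq [Fintype d] (π : d → (V →L[ℂ] ℂ)) (u v : (d → ℤ) → V) :
    bilCoeff π u v = -∑ j, conv (scal (fun p => π j (u p))) (freqDeriv j v) := rfl

/-- Unfolding of `linCoeff`. -/
theorem linCoeff_eq (ν : ℝ) (Uv : (d → ℤ) → V) (π : d → (V →L[ℂ] ℂ)) (u : (d → ℤ) → V) :
    linCoeff ν Uv π u = (ν : ℂ) • (∑ j, freqDeriv j (freqDeriv j u))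
      - ∑ j, conv (scal (fun p => π j (Uv p))) (freqDeriv j u)
      - ∑ j, conv (scal (fun p => π j (u p))) (freqDeriv j Uv) := rfl

/-! ## §3 The fields on the scaled phase space `E` -/

/-- **The linearised operator on `E`** in scaled coordinates (`⇑x = Λ² û`): the `ℓ²` element with
coefficients `Λ² (P(k) (linCoeff ν Uv π (Λ⁻² ⇑x) k))`. -/
def linOp (ν : ℝ) (Uv : (d → ℤ) → V) (π : d → (V →L[ℂ] ℂ)) (P : (d → ℤ) → (V →L[ℂ] V))
    (x : lp (fun _ : (d → ℤ) => V) 2) : lp (fun _ : (d → ℤ) => V) 2 :=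
  ofCoeff (wmul 2 fun k => P k (linCoeff ν Uv π (wmul (-2) ⇑x) k))

/-- **The bilinearity on `E`** in scaled coordinates: the `ℓ²` element with coefficients
`Λ² (P(k) (bilCoeff π (Λ⁻² ⇑x) (Λ⁻² ⇑y) k))`. -/
def bilOp (π : d → (V →L[ℂ] ℂ)) (P : (d → ℤ) → (V →L[ℂ] V))
    (x y : lp (fun _ : (d → ℤ) => V) 2) : lp (fun _ : (d → ℤ) => V) 2 :=
  ofCoeff (wmul 2 fun k => P k (bilCoeff π (wmul (-2) ⇑x) (wmul (-2) ⇑y) k))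

/-- **The full field** `F = A + B(·,·)` of the perturbation equation on `E`. -/
def nsField (ν : ℝ) (Uv : (d → ℤ) → V) (π : d → (V →L[ℂ] ℂ)) (P : (d → ℤ) → (V →L[ℂ] V))
    (x : lp (fun _ : (d → ℤ) => V) 2) : lp (fun _ : (d → ℤ) => V) 2 :=
  linOp ν Uv π P x + bilOp π P x x

/-- The split `F w = A w + B w w` holds everywhere (hypothesis `hF` of the end-to-end statement). -/
theorem nsField_eq (ν : ℝ) (Uv : (d → ℤ) → V) (π : d → (V →L[ℂ] ℂ)) (P : (d → ℤ) → (V →L[ℂ] V))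
    (x : lp (fun _ : (d → ℤ) => V) 2) : nsField ν Uv π P x = linOp ν Uv π P x + bilOp π P x x := rfl

/-- Coefficients of `linOp` where the defining family is square-summable. -/
theorem coe_linOp {ν : ℝ} {Uv : (d → ℤ) → V} {π : d → (V →L[ℂ] ℂ)} {P : (d → ℤ) → (V →L[ℂ] V)}
    {x : lp (fun _ : (d → ℤ) => V) 2}
    (h : eNormSq 0 (wmul 2 fun k => P k (linCoeff ν Uv π (wmul (-2) ⇑x) k)) < ∞) :
    ⇑(linOp ν Uv π P x) = wmul 2 fun k => P k (linCoeff ν Uv π (wmul (-2) ⇑x) k) :=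
  coe_ofCoeff_of_eNormSq_lt_top h

/-- Coefficients of `bilOp` where the defining family is square-summable. -/
theorem coe_bilOp {π : d → (V →L[ℂ] ℂ)} {P : (d → ℤ) → (V →L[ℂ] V)}
    {x y : lp (fun _ : (d → ℤ) => V) 2}
    (h : eNormSq 0 (wmul 2 fun k => P k (bilCoeff π (wmul (-2) ⇑x) (wmul (-2) ⇑y) k)) < ∞) :
    ⇑(bilOp π P x y) = wmul 2 fun k => P k (bilCoeff π (wmul (-2) ⇑x) (wmul (-2) ⇑y) k) :=
  coe_ofCoeff_of_eNormSq_lt_top h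

end Fields

/-! ## §4 The set of self-consistent bounds and the cube truncations -/

section Box

variable [NormedSpace ℂ V]

/-- **The set `W` of self-consistent bounds** with radii `ρ`: the coordinate box `‖x k‖ ≤ ρ k` cut
by «`P`-fixed modewise» (`P(k) (x k) = x k`), «real through `π`» (`π_j (x (−k)) = conj (π_j (x k))`)
and «divergence-free through `π`» (`∑_j k_j · π_j (x k) = 0`). The three constraints are modewise
(or couple only `k` and `−k`), hence closed and invariant under the symmetric cube truncations; they
are stated on the SCALED family `⇑x`, and transfer to `Λ⁻² ⇑x` because the weights are real and even. -/
def box (ρ : (d → ℤ) → ℝ) (π : d → (V →L[ℂ] ℂ)) (P : (d → ℤ) → (V →L[ℂ] V)) :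
    Set (lp (fun _ : (d → ℤ) => V) 2) :=
  {x | (∀ k, ‖x k‖ ≤ ρ k) ∧ (∀ k, P k (x k) = x k) ∧
    (∀ j k, π j (x (-k)) = conj (π j (x k))) ∧ (∀ k, ∑ j, ((k j : ℤ) : ℂ) * π j (x k) = 0)}

omit [Fintype d] in
/-- Membership in `box`, unfolded. -/
theorem mem_box [Fintype d] {ρ : (d → ℤ) → ℝ} {π : d → (V →L[ℂ] ℂ)} {P : (d → ℤ) → (V →L[ℂ] V)}
    {x : lp (fun _ : (d → ℤ) => V) 2} :
    x ∈ box ρ π P ↔ (∀ k, ‖x k‖ ≤ ρ k) ∧ (∀ k, P k (x k) = x k) ∧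
      (∀ j k, π j (x (-k)) = conj (π j (x k))) ∧ (∀ k, ∑ j, ((k j : ℤ) : ℂ) * π j (x k) = 0) :=
  Iff.rfl

variable [DecidableEq d]

/-- **The cube truncation** `P_n`: the coordinate projection of `E` onto the modes `|k|_∞ ≤ n`
(`Literature.Analysis.ODE.lpProj` on `Fintype.piFinset fun _ => Finset.Icc (−n) n`, the projections
of `GalerkinLatticePhaseSpace` §3 and `GalerkinLatticeOneSided`). -/
abbrev cubeProj (n : ℕ) : lp (fun _ : (d → ℤ) => V) 2 →L[ℝ] lp (fun _ : (d → ℤ) => V) 2 :=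
  lpProj (fun _ : (d → ℤ) => V) 2 (Fintype.piFinset fun _ : d => Finset.Icc (-(n : ℤ)) n)

/-- Unfolding of `cubeProj`. -/
theorem cubeProj_eq (n : ℕ) :
    (cubeProj n : lp (fun _ : (d → ℤ) => V) 2 →L[ℝ] lp (fun _ : (d → ℤ) => V) 2) =
      lpProj (fun _ : (d → ℤ) => V) 2 (Fintype.piFinset fun _ : d => Finset.Icc (-(n : ℤ)) n) := rfl

end Box

end Summit.NavierStokesRegularity.FluidComputer.TransportGalerkin

end
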